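import Mathlib
import Literature.NumberTheory.Irrationality.Zudilin2002.WellPoisedIntegrals
import Literature.NumberTheory.Irrationality.BrownZudilin2022.GeneralFamily
import HarnessLib

/-!
# Brown–Zudilin 2022, §9–§10: the dual very-well-poised series `F̃_k(b)`, `F₇(b)`, and the symmetric parameters

Topic `Literature/NumberTheory/Irrationality/BrownZudilin2022`. DEFINITIONS (with bodies; no named facts) read on
the page from F. Brown, W. Zudilin, *On cellular rational approximations to ζ(5)*, arXiv:2210.03391
[BrownZudilin2022], Sect. 9 ("Duality", eqs. (34)–(35) and the display `b₀ = a₂+a₃+a₄, …` at its end) and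
Sect. 10 ("Symmetric parameters and their duals": `a = a(s)`, `s = s(a)`, `b = (2s₀; s₀−s₁,…,s₀−s₇)`).
Complements `CellularZetaFive.lean` / `GeneralFamily.lean` (same namespace; `a : Fin 8 → ℤ`, index `i` for
`a_{i+1}`) and reuses `Zudilin2002.vwpSeries` (the very-well-poised series `F_k(h₀;h₁,…,h_k)` of
Zudilin, math/0206177 (1)) for (34). Requested by the cell's typer (HANDOFF item (b): the Lean home of the
objects in gen-1's "determinant dictionary"). HONEST FRAMING (cell pub-zeta5): systematic search; no
irrationality claim unless certified — nothing here asserts anything arithmetic.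

* `hOfB b` — the substitution `h₀ = b₀ + 2`, `h_j = b_j + 1` turning Zudilin's `F_k(h)` into (34);
* `vwpDual k b` — `F̃_k(b) = F̃_k(b₀; b₁,…,b_k)` of (34), DEFINED as `Zudilin2002.vwpSeries k (hOfB b)`; PROVED
  `vwpDual_eq_tsum`: it is the printed series
  `Σ_{μ≥0} (b₀+2μ+2) · Γ(b₀+μ+2) ∏_{j=1}^{k} Γ(b_j+μ+1) / (μ! ∏_{j=1}^{k} Γ(b₀−b_j+μ+2)) · (−1)^{(k+1)μ}`
  [BrownZudilin2022, (34)] (there: `b_j` non-negative integers, `b₀ ≥ 2b_i`, `k ≥ 4`; the definition is total —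
  a real `tsum`, `0` if not summable);
* `F7 b` — the arithmetic renormalisation (35)
  `F₇(b) = (b₀−b₁−b₆)!(b₀−b₁−b₇)!(b₀−b₂−b₇)!(b₀−b₃−b₅)!(b₀−b₄−b₅)!(b₀−b₄−b₆)!/(b₂! b₃!) · F̃₇(b)`
  (factorials of the integer arguments through `Int.toNat`, i.e. junk `(−m)! = 1` off the cone where they are
  non-negative) [BrownZudilin2022, (35)]; NOT typed: the membership `F₇(b) ∈ ℚ + ℚζ(3) + ℤζ(5)` printed under
  (35) (it rests on [26, Sect. 3] = Zudilin, JTNB 15 (2003)) and the identification `F₇(b) = (33)` (via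
  [23, Thm 2], [26, Thm 5]) — both would be named facts; the cell states its conjectures over partial-fraction
  data (`Literature.NumberTheory.Transcendental.BallRivoal.pfEval`) instead;
* `bOfA a` — `b₀ = a₂+a₃+a₄, b₁ = −a₁+a₃+a₄, b₂ = a₂, b₃ = a₄, b₄ = a₂+a₃−a₅, b₅ = a₂+a₃−a₈, b₆ = a₄−a₆+a₈,
  b₇ = a₂+a₃+a₆−a₇−a₈` [BrownZudilin2022, Sect. 9, last display];
* `sOfA a`, `aOfS s`, `bOfS s` — the symmetric (half-integer) parameters of Sect. 10 and their inverse, and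
  `b = (2s₀; s₀−s₁, …, s₀−s₇)`; PROVED: `aOfS_sOfA` (the two displays are inverse), `bOfS_sOfA` ("This change
  of variables is equivalent to the equations for b₀,…,b₇ in terms of a₁,…,a₈ stated at the very end of
  Section 9"), and the record values `bOfA recordVec = (41; 17,16,15,14,13,12,11)`,
  `sOfA recordVec = (41/2; 7/2, 9/2, 11/2, 13/2, 15/2, 17/2, 19/2)`.
-/

noncomputable section

open Finset

namespace Literature.NumberTheory.Irrationality.BrownZudilin2022

/-! ### (34): the dual very-well-poised series -/

/-- The substitution `h₀ = b₀ + 2`, `h_j = b_j + 1 (j ≥ 1)` from Zudilin's parameters `h` (math/0206177 (1)) to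
Brown–Zudilin's `b` in (34). [cite: BrownZudilin2022, Sect. 9, eq. (34)] -/
def hOfB (b : ℕ → ℤ) : ℕ → ℝ := fun j => if j = 0 then (b 0 : ℝ) + 2 else (b j : ℝ) + 1

/-- `F̃_k(b) = F̃_k(b₀; b₁,…,b_k)` of (34), as Zudilin's very-well-poised series `F_k(h₀;h₁,…,h_k)` at
`h = hOfB b` (real `tsum`; see `vwpDual_eq_tsum` for the printed shape). [cite: BrownZudilin2022, Sect. 9, eq. (34)] -/
def vwpDual (k : ℕ) (b : ℕ → ℤ) : ℝ := Zudilin2002.vwpSeries k (hOfB b)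

/-- `F̃_k(b)` is the printed series (34):
`Σ_{μ≥0} (b₀+2μ+2) · (Γ(b₀+μ+2) ∏_{j=1}^{k} Γ(b_j+μ+1)) / (μ! ∏_{j=1}^{k} Γ(b₀−b_j+μ+2)) · (−1)^{(k+1)μ}`
(the products written over `j+1`, `j < k`). [cite: BrownZudilin2022, Sect. 9, eq. (34)] -/
theorem vwpDual_eq_tsum (k : ℕ) (b : ℕ → ℤ) :
    vwpDual k b = ∑' μ : ℕ, ((b 0 : ℝ) + 2 * μ + 2) *
      ((Real.Gamma ((b 0 : ℝ) + μ + 2) * ∏ j ∈ range k, Real.Gamma ((b (j + 1) : ℝ) + μ + 1)) /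
        ((μ.factorial : ℝ) * ∏ j ∈ range k, Real.Gamma ((b 0 : ℝ) - b (j + 1) + μ + 2))) *
      (-1 : ℝ) ^ ((k + 1) * μ) := by
  unfold vwpDual Zudilin2002.vwpSeries
  refine tsum_congr fun μ => ?_
  have h0 : hOfB b 0 = (b 0 : ℝ) + 2 := by simp [hOfB]
  have hj : ∀ j, hOfB b (j + 1) = (b (j + 1) : ℝ) + 1 := fun j => by simp [hOfB]
  rw [prod_range_succ', h0]
  simp only [hj]
  have hΓ : Real.Gamma (1 + ((b 0 : ℝ) + 2) - ((b 0 : ℝ) + 2) + μ) = (μ.factorial : ℝ) := by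
    rw [show (1 + ((b 0 : ℝ) + 2) - ((b 0 : ℝ) + 2) + μ) = (μ : ℝ) + 1 by ring, Real.Gamma_nat_eq_factorial]
  rw [hΓ, prod_div_distrib]
  have e1 : ((b 0 : ℝ) + 2 + 2 * μ) = (b 0 : ℝ) + 2 * μ + 2 := by ring
  have e2 : ((b 0 : ℝ) + 2 + μ) = (b 0 : ℝ) + μ + 2 := by ring
  have e3 : ∀ j, ((b (j + 1) : ℝ) + 1 + μ) = (b (j + 1) : ℝ) + μ + 1 := fun j => by ring
  have e4 : ∀ j, (1 + ((b 0 : ℝ) + 2) - ((b (j + 1) : ℝ) + 1) + μ) = (b 0 : ℝ) - b (j + 1) + μ + 2 :=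
    fun j => by ring
  simp only [e1, e2, e3, e4]
  ring

/-! ### (35): the arithmetic renormalisation `F₇(b)` -/

/-- Factorial of an integer through `Int.toNat` (`z! ` for `z ≥ 0`; junk `1` for `z < 0`). [folklore] -/
def zfact (z : ℤ) : ℕ := z.toNat.factorial

/-- `F₇(b)` of (35):
`(b₀−b₁−b₆)!(b₀−b₁−b₇)!(b₀−b₂−b₇)!(b₀−b₃−b₅)!(b₀−b₄−b₅)!(b₀−b₄−b₆)!/(b₂! b₃!) · F̃₇(b)`.
[cite: BrownZudilin2022, Sect. 9, eq. (35)] -/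
def F7 (b : ℕ → ℤ) : ℝ :=
  ((zfact (b 0 - b 1 - b 6) * zfact (b 0 - b 1 - b 7) * zfact (b 0 - b 2 - b 7) *
      zfact (b 0 - b 3 - b 5) * zfact (b 0 - b 4 - b 5) * zfact (b 0 - b 4 - b 6) : ℕ) : ℝ) /
    ((zfact (b 2) * zfact (b 3) : ℕ) : ℝ) * vwpDual 7 b

/-! ### The dual parameters `b(a)` (end of Sect. 9) and the symmetric parameters `s` (Sect. 10) -/

/-- `b(a)`: `b₀ = a₂+a₃+a₄, b₁ = −a₁+a₃+a₄, b₂ = a₂, b₃ = a₄, b₄ = a₂+a₃−a₅, b₅ = a₂+a₃−a₈, b₆ = a₄−a₆+a₈,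
b₇ = a₂+a₃+a₆−a₇−a₈` (and `0` beyond index 7). [cite: BrownZudilin2022, Sect. 9, last display] -/
def bOfA (a : Fin 8 → ℤ) : ℕ → ℤ
  | 0 => a 1 + a 2 + a 3
  | 1 => -a 0 + a 2 + a 3
  | 2 => a 1
  | 3 => a 3
  | 4 => a 1 + a 2 - a 4
  | 5 => a 1 + a 2 - a 7
  | 6 => a 3 - a 5 + a 7
  | 7 => a 1 + a 2 + a 5 - a 6 - a 7
  | _ => 0

/-- The symmetric parameters `s₀,…,s₇` of Sect. 10 (half-integers in general):
`s₀ = (a₂+a₃+a₄)/2, s₁ = a₁+(a₂−a₃−a₄)/2, s₂ = (a₃+a₄−a₂)/2, s₃ = (a₂+a₃−a₄)/2, s₄ = a₅+(a₄−a₂−a₃)/2,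
s₅ = a₈+(a₄−a₂−a₃)/2, s₆ = a₆−a₈+(a₂+a₃−a₄)/2, s₇ = a₇+a₈−a₆+(a₄−a₂−a₃)/2` (and `0` beyond index 7).
[cite: BrownZudilin2022, Sect. 10, the inverse transformation] -/
def sOfA (a : Fin 8 → ℤ) : ℕ → ℚ
  | 0 => ((a 1 + a 2 + a 3 : ℤ) : ℚ) / 2
  | 1 => (a 0 : ℚ) + ((a 1 - a 2 - a 3 : ℤ) : ℚ) / 2
  | 2 => ((a 2 + a 3 - a 1 : ℤ) : ℚ) / 2
  | 3 => ((a 1 + a 2 - a 3 : ℤ) : ℚ) / 2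
  | 4 => (a 4 : ℚ) + ((a 3 - a 1 - a 2 : ℤ) : ℚ) / 2
  | 5 => (a 7 : ℚ) + ((a 3 - a 1 - a 2 : ℤ) : ℚ) / 2
  | 6 => (a 5 : ℚ) - a 7 + ((a 1 + a 2 - a 3 : ℤ) : ℚ) / 2
  | 7 => (a 6 : ℚ) + a 7 - a 5 + ((a 3 - a 1 - a 2 : ℤ) : ℚ) / 2
  | _ => 0

/-- `a(s)`: `a₁ = s₁+s₂, a₂ = s₀−s₂, a₃ = s₂+s₃, a₄ = s₀−s₃, a₅ = s₃+s₄, a₆ = s₅+s₆, a₇ = s₆+s₇, a₈ = s₃+s₅`.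
[cite: BrownZudilin2022, Sect. 10, first display] -/
def aOfS (s : ℕ → ℚ) : Fin 8 → ℚ :=
  ![s 1 + s 2, s 0 - s 2, s 2 + s 3, s 0 - s 3, s 3 + s 4, s 5 + s 6, s 6 + s 7, s 3 + s 5]

/-- The dual parameters from the symmetric ones: `b = (2s₀; s₀−s₁, s₀−s₂, …, s₀−s₇)` (and `0` beyond 7).
[cite: BrownZudilin2022, Sect. 10, display after (36)] -/
def bOfS (s : ℕ → ℚ) : ℕ → ℚ := fun j =>
  if j = 0 then 2 * s 0 else if j ≤ 7 then s 0 - s j else 0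

/-- The two displays of Sect. 10 are inverse to each other: `a(s(a)) = a`. [cite: BrownZudilin2022, Sect. 10] -/
theorem aOfS_sOfA (a : Fin 8 → ℤ) : aOfS (sOfA a) = fun i => (a i : ℚ) := by
  ext i
  fin_cases i <;> simp [aOfS, sOfA] <;> ring

/-- "This change of variables is equivalent to the equations for `b₀,…,b₇` in terms of `a₁,…,a₈` stated at
the very end of Section 9": `b(s(a)) = b(a)`. [cite: BrownZudilin2022, Sect. 10 (paragraph after (36))] -/
theorem bOfS_sOfA (a : Fin 8 → ℤ) (j : ℕ) : bOfS (sOfA a) j = (bOfA a j : ℚ) := by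
  rcases Nat.lt_or_ge j 8 with hj | hj
  · interval_cases j <;> simp [bOfS, sOfA, bOfA] <;> ring
  · have h1 : j ≠ 0 := by omega
    have h2 : ¬ j ≤ 7 := by omega
    have h3 : bOfA a j = 0 := by
      match j, hj with
      | n + 8, _ => rfl
    simp [bOfS, h1, h2, h3]

/-- The record vector `a = (8,16,10,15,12,16,18,13)` has dual parameters `b = (41; 17,16,15,14,13,12,11)`.
[cite: BrownZudilin2022, Sect. 9–11 (evaluation of the printed formulae)] -/
theorem bOfA_recordVec :
    (List.range 8).map (bOfA recordVec) = [41, 17, 16, 15, 14, 13, 12, 11] := by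
  decide

/-- … and symmetric parameters `s = (41/2; 7/2, 9/2, 11/2, 13/2, 15/2, 17/2, 19/2)`.
[cite: BrownZudilin2022, Sect. 10–11 (evaluation of the printed formulae)] -/
theorem sOfA_recordVec :
    (List.range 8).map (sOfA recordVec) = [41/2, 7/2, 9/2, 11/2, 13/2, 15/2, 17/2, 19/2] := by
  simp [sOfA, recordVec, List.range, List.range.loop]
  norm_num

end Literature.NumberTheory.Irrationality.BrownZudilin2022
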